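import Summits.Ventures.CertifiedManyBodySolver.Theses.CovHg1201M19b
import Summits.Ventures.CertifiedManyBodySolver.Observables.RungLeavesCoverageHg1201PatchL
import Summits.Ventures.CertifiedManyBodySolver.Rows.DopedTLCorrBox
import Summits.Ventures.CertifiedManyBodySolver.Observables.StiffnessTLKineticTT
import HarnessLib

/-!
# Theorems/CovHg1201M19bPatchAdapters.lean — ADAPTERS for the cruxes of route `CovHg1201M19b` («hubbard-cov-hg1201-1»)

Supports items **stmt-Ventures-26186 `PatchLeftEdge`** (rank 2) and **stmt-Ventures-26187 `PatchBottom`** (rank 3) of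
`Summits/Ventures/CertifiedManyBodySolver/Theses/CovHg1201M19b.lean` (route OPENED 2026-08-28T06:25:13Z). The items quantify over EVERY target slot
`σ ∈ [−27/50, −13/25]`; the captain's note N1 (HG1201-COVERAGE-PLAN v0.2, hubbard-obs STATUS 06:33:50Z / INBOX l.427: «corner-objective reads ONLY are owed;
ADAPTERS asked of box-1») is discharged here:

* §1 `covHg1201M19b_PatchLeftEdge_of_cornerObjective` — per density `n ∈ [87/100, 183/200]` and station `U′ ∈ [7/2, 44/5]`, ONE orbit-lower value `vL n U′` for
  the CORNER objective `−X₀(−27/50, U′)` on the torus-limit ground-state class at `(−27/50, U′, n)` with `−vL n U′ ≤ 0.5166800` ⇒ `PatchLeftEdge` (every slot `σ`):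
  the inner-END read `−X₀(−13/25, U′)` is KINEMATIC (hubbard-cov-hg1201-box-2's `orbitMean_neg_oddMomentTT_lam_zero_ge_kinematic_of_gs` on `halfBathtub_m13o25_chordLevel_le`,
  value `≥ −0.5152137 ≥ −0.5166800` at `n ≤ 183/200`) and the `σ`-CHORD of the two END reads (`orbitLower_slot_chord_of_two_endObjectives`, hubbard-downfold-unc-2) is
  `≥ −0.5166800` as a convex combination; `covHg1201M19b_PatchBottom_of_cornerObjective` likewise (sources `s ∈ [−27/50, σ] ⊆ [−27/50, −13/25]` at `U = 7/2`).
* §2 THE READ-SHAPE ADAPTERS (S1 «U-segment reader», owner = this seat, hubbard-obs RULING (ppp) d312 (ppp3) + captain RULING C-S1 06:37:47Z: instrument of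
  record = the `boxdual/0` region-valid U-SEGMENT read; tree cell = hubbard-box-eng-3's `SquareTTPrimeCorrOrbitLowerBoxRow lo hi cap r S Λ X` of
  `Rows/DopedTLCorrBox.lean`, BOXDUAL-FORMAT §17, emitted per cell by `boxdual.leannodes`): `covHg1201M19b_PatchLeftEdge_of_edgeBoxRows` — TWO left-edge U-segment
  cells `![7/2, −27/50, 87/100]…![5, −27/50, 183/200]` and `![5, …]…![44/5, −27/50, 183/200]` (router order `(U, t′, n)`; degenerate in `t′`), word `−X₀(−27/50)`
  (any `U`-label: `λ = 0`), caps DISCHARGED on the cells, slots `−r ≤ 0.5166800` ⇒ `PatchLeftEdge`; `…_oneUSegment` (one cell `[7/2, 44/5]`); `…_ladder` (any finite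
  `U`-partition `P 0 = 7/2, …, P m = 44/5` — the captain's bisection rule C-S1 (3)); `covHg1201M19b_PatchBottom_of_bottomBoxRow` — ONE short-bottom `t′`-segment cell
  `![7/2, −27/50, 87/100]…![7/2, −13/25, 183/200]` ⇒ `PatchBottom`.
* §3 the leaf through the route's own deciding theorem `closes` from the same rows (bookkeeping; the Assembly item itself is the route seats').

So the production path per crux is: `boxdual/0` read(s) (hubbard-cov-hg1201-sdp-2 left-edge vertex legs A7o2 j300184 / A5 j300186 / A44o5 j300273 as U-segment bundles;
sdp-1 / gen-1 corner + `(7/2, 183/200, −13/25)` parents as the bottom bundle; density-extent `[87/100, 183/200]` per BOXDUAL §11) → `leannodes` claim node(s) in the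
hypothesis shapes below → cap-discharge lemma(s) (this seat's windows files `Certificates/HubbardSquare_Hg1201_M19b_station_apriori_windows{,_hf}.lean` give the vertex
values; the U-affine HF row `hfCap_hg1201st_m540_n0915_point` is the cap named by C-S1 (1)) → ONE `exact` here. Pass criterion per two-vertex segment (captain C-S1 (2)):
`L₁₂ ≤ (√m₁ + √m₂)²`, `m_v = 0.5166800 − w(U_v)`.

All PROVED; zero solve, no definition, no claim node, no `sorry`. HONEST FRAMING: obligation-shape adapters, CONDITIONAL on rows no certificate supplies yet; wording
class (xx1): certified stiffness CEILINGS on a downfolded box = CONTROL / CALIBRATION + labelled heuristic; «content» = below `0.98 ×` the kinematic MAJORANT word —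
no suppression below free fermions claimed (interim bar rule); a ceiling never speaks to the presence of superconductivity; never «certified true negative / positive»;
not a `T_c` or phase sentence; NO item and NO rung leaf is proved here.

Cell `pub/hubbard-obs` (LADDER-HUBBARD MO-S2, D-0154 (1)(C) Hg-1201), seat `hubbard-cov-hg1201-box-1` (`prover-hubbard-cov-hg1201-box-1-0`, explicit-unit; lanes of
record: windows / caps / node shapes / one-`exact` closers on R / S1 reader owner).
References: T. Koma, H. Tasaki, J. Stat. Phys. 76 (1994) 745, §1 [KomaTasaki1994]; D. J. Scalapino, S. R. White, S.-C. Zhang, PRB 47 (1993) 7995, §II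
[ScalapinoWhiteZhang1993]; T. Hazra, N. Verma, M. Randeria, PRX 9 (2019) 031049, eqs. (2)–(6) [HazraVermaRanderia2019]; S. Boyd, L. Vandenberghe,
*Convex Optimization* (2004) §5.9 [BoydVandenberghe2004].
-/

noncomputable section

namespace Summit.Ventures.CertifiedManyBodySolver.Theorems

open Real Set NonemptyInterval Filter Topology
open Summit.Ventures.CertifiedManyBodySolver.Theses.CovHg1201M19b
open Summit.Ventures.CertifiedManyBodySolver.Observables
open Summit.Ventures.CertifiedManyBodySolver.Downfold
open Summit.Ventures.CertifiedManyBodySolver.Certificates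
open Summit.Ventures.CertifiedManyBodySolver
open Literature.MathematicalPhysics.QuantumLattice Literature.MathematicalPhysics.QuantumLattice.ThermodynamicLimit
open Literature.Probability.LatticeModels
open Matrix HubbardWave0
open scoped BigOperators ComplexOrder

/-! ## §0 Small tools -/

/-- At `λ = 0` the f-sum objective word carries no `U`: `−X₀(t′; U) = −X₀(t′; U′)` (`oddMomentObsTT_lam_zero`). [cite: ScalapinoWhiteZhang1993, §II] -/
theorem covHg1201_neg_oddMomentObsTT_lam_zero_label (tp U U' : ℝ) : -oddMomentObsTT tp U 0 = -oddMomentObsTT tp U' 0 := by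
  rw [oddMomentObsTT_lam_zero tp U, oddMomentObsTT_lam_zero tp U']

/-- Membership of a literal triple in a literal `Fin 3` box (router order `(U, t′, n)`). [folklore] -/
theorem covHg1201_vec3_mem_Icc {a b c a' b' c' x y z : ℝ} (hx : a ≤ x) (hx' : x ≤ a') (hy : b ≤ y) (hy' : y ≤ b') (hz : c ≤ z) (hz' : z ≤ c') :
    (![x, y, z] : Fin 3 → ℝ) ∈ Set.Icc (![a, b, c] : Fin 3 → ℝ) ![a', b', c'] := by
  refine ⟨fun i => ?_, fun i => ?_⟩ <;> fin_cases i <;> simp [hx, hx', hy, hy', hz, hz']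

/-- Reading a box row (`Rows/DopedTLCorrBox`) at the literal point `![U, t′, n]` of its cell, cap discharged: the orbit-lower statement on the torus-limit
ground-state class at `(t′, U, n)` for the word `X`. [cite: BoydVandenberghe2004, §5.9] -/
theorem covHg1201_boxRow_orbitLower_at {lo hi : Fin 3 → ℝ} {cap : (Fin 3 → ℝ) → ℝ} {r : ℚ}
    {X : FermionOp (box 2 7)} (h : SquareTTPrimeCorrOrbitLowerBoxRow lo hi cap r Finset.univ (box 2 7) X)
    (hcap : ∀ θ ∈ Set.Icc lo hi, energyDensityTT' 1 (θ 1) (θ 0) (θ 2) ≤ cap θ)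
    {U tp n : ℝ} (hθ : (![U, tp, n] : Fin 3 → ℝ) ∈ Set.Icc lo hi) :
    ∀ (ω : InfVolFermionState 2) (Ls : ℕ → ℕ) (ψ : ∀ L, Fock (Orb (FermionTorus 2 L))),
      Tendsto Ls atTop atTop →
      (∀ j, IsGroundStateInSector (hubbardTorusTT' (Ls j) 1 tp U) (rectN n (Ls j)) 0 (ψ (Ls j))) →
      (∀ j, star (ψ (Ls j)) ⬝ᵥ ψ (Ls j) = 1) → ω.IsTorusLimitOf ψ Ls →
      ((r : ℚ) : ℝ) ≤ ((Finset.univ : Finset (DihedralGroup 4)).card : ℝ)⁻¹ * ∑ g ∈ (Finset.univ : Finset (DihedralGroup 4)),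
        (ω.expect (d4ShiftSet g 0 (box 2 7)) (fermionEmbed (PolySite.d4Emb g 0 (box 2 7)) X)).re :=
  fun ω Ls ψ hLs hψ h1 hω => h.uncond hcap _ hθ ω Ls ψ hLs hψ h1 hω

/-- Locating a point of `[P 0, P m]` in a segment `[P k, P (k+1)]`, `k < m` (no monotonicity needed). [folklore] -/
theorem covHg1201_exists_ladder_segment (P : ℕ → ℝ) :
    ∀ m : ℕ, 0 < m → ∀ U' : ℝ, P 0 ≤ U' → U' ≤ P m → ∃ k < m, P k ≤ U' ∧ U' ≤ P (k + 1)
  | 0, hm, _, _, _ => (Nat.lt_irrefl 0 hm).elim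
  | (m + 1), _, U', h0, hm1 => by
      by_cases hle : U' ≤ P m
      · rcases Nat.eq_zero_or_pos m with hm0 | hmpos
        · subst hm0
          exact ⟨0, Nat.zero_lt_succ 0, h0, hm1⟩
        · obtain ⟨k, hk, h1, h2⟩ := covHg1201_exists_ladder_segment P m hmpos U' h0 hle
          exact ⟨k, Nat.lt_succ_of_lt hk, h1, h2⟩
      · exact ⟨m, Nat.lt_succ_self m, le_of_lt (not_le.mp hle), hm1⟩

/-! ## §1 N1: the cruxes from CORNER-OBJECTIVE reads only (the inner END is kinematic, the `σ`-chord is convex) -/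

/-- **`PatchLeftEdge` (stmt-Ventures-26186) FROM CORNER-OBJECTIVE READS ONLY.** Per density `n ∈ [87/100, 183/200]` and station `U′ ∈ [7/2, 44/5]`: an orbit-lower value
`vL n U′` for `−X₀(−27/50, U′)` on the torus-limit ground-state class at `(−27/50, U′, n)`, with `−vL n U′ ≤ 0.5166800`. Then the item holds at EVERY slot
`σ ∈ [−27/50, −13/25]`: `σ`-chord of the corner read and box-2's kinematic inner read (`≥ −0.5152137`). [cite: KomaTasaki1994, §1] [cite: ScalapinoWhiteZhang1993, §II] -/
theorem covHg1201M19b_PatchLeftEdge_of_cornerObjective (vL : ℝ → ℝ → ℝ)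
    (hL : ∀ n ∈ Set.Icc (87 / 100 : ℝ) (183 / 200), ∀ U' ∈ Set.Icc (7 / 2 : ℝ) (44 / 5),
      ∀ (ω : InfVolFermionState 2) (Ls : ℕ → ℕ) (ψ : ∀ L, Fock (Orb (FermionTorus 2 L))),
      Tendsto Ls atTop atTop →
      (∀ j, IsGroundStateInSector (hubbardTorusTT' (Ls j) 1 (-27 / 50) U') (rectN n (Ls j)) 0 (ψ (Ls j))) →
      (∀ j, star (ψ (Ls j)) ⬝ᵥ ψ (Ls j) = 1) → ω.IsTorusLimitOf ψ Ls →
      vL n U' ≤ ((Finset.univ : Finset (DihedralGroup 4)).card : ℝ)⁻¹ * ∑ g ∈ (Finset.univ : Finset (DihedralGroup 4)),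
        (ω.expect (d4ShiftSet g 0 (box 2 7)) (fermionEmbed (PolySite.d4Emb g 0 (box 2 7)) (-oddMomentObsTT (-27 / 50) U' 0))).re)
    (hcL : ∀ n ∈ Set.Icc (87 / 100 : ℝ) (183 / 200), ∀ U' ∈ Set.Icc (7 / 2 : ℝ) (44 / 5), -vL n U' ≤ (5166800 / 10000000 : ℝ)) :
    PatchLeftEdge := by
  intro n hn σ hσ U' hU' ω Ls ψ hLs hψ h1 hω
  have hn0 : 0 ≤ n := by linarith [hn.1]
  have hn2 : n < 2 := by linarith [hn.2]
  -- kinematic inner-END read at this density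
  have hKQc : -(-((43731 / 90112 : ℝ) * n / 2 + ((9 / 11 : ℝ) * 0.3123804228 + 2 / 11 * 0.2068368242))) ≤
      (5166800 / 10000000 : ℝ) := by
    rw [neg_neg]
    have h := hg1201_innerKinematicReading_le hn.2
    push_cast at h
    linarith
  have hchord := orbitLower_slot_chord_of_two_endObjectives hω.isTranslationInvariant U' (by norm_num : (-27 / 50 : ℝ) < -13 / 25) hσ
    (hL n hn U' hU' ω Ls ψ hLs hψ h1 hω)
    (orbitMean_neg_oddMomentTT_lam_zero_ge_kinematic_of_gs (-13 / 25) U' (-27 / 50) U' halfBathtub_m13o25_chordLevel_le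
      hn0 hn2 ω Ls ψ hLs hψ h1 hω)
  obtain ⟨ha, hb, hab⟩ := hg1201_patch_slotWeights hσ
  have hprice := neg_convexComb_le_of_neg_le ha hb hab (hcL n hn U' hU') hKQc
  linarith

/-- **`PatchBottom` (stmt-Ventures-26187) FROM CORNER-OBJECTIVE READS ONLY.** Per density `n` and source `s ∈ [−27/50, −13/25]` at the station `U = 7/2`: an orbit-lower
value `vB n s` for `−X₀(−27/50, 7/2)` on the class at `(s, 7/2, n)`, with `−vB n s ≤ 0.5166800` ⇒ the item at every slot `σ ∈ [−27/50, −13/25]` and source `s ∈ [−27/50, σ]`.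
[cite: KomaTasaki1994, §1] [cite: ScalapinoWhiteZhang1993, §II] -/
theorem covHg1201M19b_PatchBottom_of_cornerObjective (vB : ℝ → ℝ → ℝ)
    (hB : ∀ n ∈ Set.Icc (87 / 100 : ℝ) (183 / 200), ∀ s ∈ Set.Icc (-27 / 50 : ℝ) (-13 / 25),
      ∀ (ω : InfVolFermionState 2) (Ls : ℕ → ℕ) (ψ : ∀ L, Fock (Orb (FermionTorus 2 L))),
      Tendsto Ls atTop atTop →
      (∀ j, IsGroundStateInSector (hubbardTorusTT' (Ls j) 1 s (7 / 2)) (rectN n (Ls j)) 0 (ψ (Ls j))) →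
      (∀ j, star (ψ (Ls j)) ⬝ᵥ ψ (Ls j) = 1) → ω.IsTorusLimitOf ψ Ls →
      vB n s ≤ ((Finset.univ : Finset (DihedralGroup 4)).card : ℝ)⁻¹ * ∑ g ∈ (Finset.univ : Finset (DihedralGroup 4)),
        (ω.expect (d4ShiftSet g 0 (box 2 7)) (fermionEmbed (PolySite.d4Emb g 0 (box 2 7)) (-oddMomentObsTT (-27 / 50) (7 / 2) 0))).re)
    (hcB : ∀ n ∈ Set.Icc (87 / 100 : ℝ) (183 / 200), ∀ s ∈ Set.Icc (-27 / 50 : ℝ) (-13 / 25), -vB n s ≤ (5166800 / 10000000 : ℝ)) :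
    PatchBottom := by
  intro n hn σ hσ s hs ω Ls ψ hLs hψ h1 hω
  have hn0 : 0 ≤ n := by linarith [hn.1]
  have hn2 : n < 2 := by linarith [hn.2]
  have hsI : s ∈ Set.Icc (-27 / 50 : ℝ) (-13 / 25) := ⟨hs.1, hs.2.trans hσ.2⟩
  have hKQc : -(-((43731 / 90112 : ℝ) * n / 2 + ((9 / 11 : ℝ) * 0.3123804228 + 2 / 11 * 0.2068368242))) ≤
      (5166800 / 10000000 : ℝ) := by
    rw [neg_neg]
    have h := hg1201_innerKinematicReading_le hn.2
    push_cast at h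
    linarith
  have hchord := orbitLower_slot_chord_of_two_endObjectives hω.isTranslationInvariant (7 / 2) (by norm_num : (-27 / 50 : ℝ) < -13 / 25) hσ
    (hB n hn s hsI ω Ls ψ hLs hψ h1 hω)
    (orbitMean_neg_oddMomentTT_lam_zero_ge_kinematic_of_gs (-13 / 25) (7 / 2) s (7 / 2) halfBathtub_m13o25_chordLevel_le
      hn0 hn2 ω Ls ψ hLs hψ h1 hω)
  obtain ⟨ha, hb, hab⟩ := hg1201_patch_slotWeights hσ
  have hprice := neg_convexComb_le_of_neg_le ha hb hab (hcB n hn s hsI) hKQc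
  linarith

/-! ## §2 THE READ-SHAPE ADAPTERS (`boxdual/0` tree cells `SquareTTPrimeCorrOrbitLowerBoxRow`) -/

/-- **`PatchLeftEdge` FROM TWO LEFT-EDGE U-SEGMENT BOX ROWS** (router order `(U, t′, n)`): cells `![7/2, −27/50, 87/100]…![5, −27/50, 183/200]` and
`![5, −27/50, 87/100]…![44/5, −27/50, 183/200]`, word `−X₀(−27/50)` with any `U`-label `Uo`, caps discharged on each cell, slots `−rL₁, −rL₂ ≤ 0.5166800`.
One `exact` away from two `leannodes` claim nodes (captain C-S1 (1): vertices = sdp-2's A7o2 / A5 / A44o5 point legs; cap = the U-affine HF row; floor = chord).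
[cite: KomaTasaki1994, §1] [cite: BoydVandenberghe2004, §5.9] -/
theorem covHg1201M19b_PatchLeftEdge_of_edgeBoxRows {capL₁ capL₂ : (Fin 3 → ℝ) → ℝ} {rL₁ rL₂ : ℚ} (Uo : ℝ)
    (hrowL₁ : SquareTTPrimeCorrOrbitLowerBoxRow ![7 / 2, -27 / 50, 87 / 100] ![5, -27 / 50, 183 / 200] capL₁ rL₁ Finset.univ (box 2 7)
      (-oddMomentObsTT (-27 / 50) Uo 0))
    (hcapL₁ : ∀ θ ∈ Set.Icc (![7 / 2, -27 / 50, 87 / 100] : Fin 3 → ℝ) ![5, -27 / 50, 183 / 200],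
      energyDensityTT' 1 (θ 1) (θ 0) (θ 2) ≤ capL₁ θ)
    (hrowL₂ : SquareTTPrimeCorrOrbitLowerBoxRow ![5, -27 / 50, 87 / 100] ![44 / 5, -27 / 50, 183 / 200] capL₂ rL₂ Finset.univ (box 2 7)
      (-oddMomentObsTT (-27 / 50) Uo 0))
    (hcapL₂ : ∀ θ ∈ Set.Icc (![5, -27 / 50, 87 / 100] : Fin 3 → ℝ) ![44 / 5, -27 / 50, 183 / 200],
      energyDensityTT' 1 (θ 1) (θ 0) (θ 2) ≤ capL₂ θ)
    (hrL₁ : -((rL₁ : ℚ) : ℝ) ≤ (5166800 / 10000000 : ℝ)) (hrL₂ : -((rL₂ : ℚ) : ℝ) ≤ (5166800 / 10000000 : ℝ)) :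
    PatchLeftEdge := by
  classical
  refine covHg1201M19b_PatchLeftEdge_of_cornerObjective (fun _ U' => if U' ≤ 5 then ((rL₁ : ℚ) : ℝ) else ((rL₂ : ℚ) : ℝ))
    (fun n hn U' hU' ω Ls ψ hLs hψ h1 hω => ?_) (fun n hn U' hU' => ?_)
  · rw [covHg1201_neg_oddMomentObsTT_lam_zero_label (-27 / 50) U' Uo]
    by_cases hU5 : U' ≤ 5
    · rw [if_pos hU5]
      exact covHg1201_boxRow_orbitLower_at hrowL₁ hcapL₁ (covHg1201_vec3_mem_Icc hU'.1 hU5 le_rfl le_rfl hn.1 hn.2) ω Ls ψ hLs hψ h1 hω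
    · rw [if_neg hU5]
      exact covHg1201_boxRow_orbitLower_at hrowL₂ hcapL₂ (covHg1201_vec3_mem_Icc (le_of_lt (not_le.mp hU5)) hU'.2 le_rfl le_rfl hn.1 hn.2)
        ω Ls ψ hLs hψ h1 hω
  · by_cases hU5 : U' ≤ 5
    · rw [if_pos hU5]; exact hrL₁
    · rw [if_neg hU5]; exact hrL₂

/-- **`PatchLeftEdge` FROM ONE LEFT-EDGE U-SEGMENT BOX ROW** on `[7/2, 44/5]` (if the two-vertex bundle `{w(7/2), w(44/5)}` passes C-S1 (2) by itself). [cite: BoydVandenberghe2004, §5.9] -/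
theorem covHg1201M19b_PatchLeftEdge_of_edgeBoxRow_oneUSegment {capL : (Fin 3 → ℝ) → ℝ} {rL : ℚ} (Uo : ℝ)
    (hrowL : SquareTTPrimeCorrOrbitLowerBoxRow ![7 / 2, -27 / 50, 87 / 100] ![44 / 5, -27 / 50, 183 / 200] capL rL Finset.univ (box 2 7)
      (-oddMomentObsTT (-27 / 50) Uo 0))
    (hcapL : ∀ θ ∈ Set.Icc (![7 / 2, -27 / 50, 87 / 100] : Fin 3 → ℝ) ![44 / 5, -27 / 50, 183 / 200],
      energyDensityTT' 1 (θ 1) (θ 0) (θ 2) ≤ capL θ)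
    (hrL : -((rL : ℚ) : ℝ) ≤ (5166800 / 10000000 : ℝ)) :
    PatchLeftEdge := by
  refine covHg1201M19b_PatchLeftEdge_of_cornerObjective (fun _ _ => ((rL : ℚ) : ℝ))
    (fun n hn U' hU' ω Ls ψ hLs hψ h1 hω => ?_) (fun n hn U' hU' => hrL)
  rw [covHg1201_neg_oddMomentObsTT_lam_zero_label (-27 / 50) U' Uo]
  exact covHg1201_boxRow_orbitLower_at hrowL hcapL (covHg1201_vec3_mem_Icc hU'.1 hU'.2 le_rfl le_rfl hn.1 hn.2) ω Ls ψ hLs hψ h1 hω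

/-- **`PatchLeftEdge` FROM A LADDER OF LEFT-EDGE U-SEGMENT BOX ROWS** along any finite `U`-partition `P 0 = 7/2, …, P m = 44/5` (the captain's bisection rule
C-S1 (3): one box row per worded sub-segment `[P k, P (k+1)]`, caps discharged, slots under the bar). [cite: BoydVandenberghe2004, §5.9] -/
theorem covHg1201M19b_PatchLeftEdge_of_edgeBoxRows_ladder (P : ℕ → ℝ) {m : ℕ} (hP0 : P 0 = 7 / 2) (hPm : P m = 44 / 5)
    (capL : ℕ → (Fin 3 → ℝ) → ℝ) (rL : ℕ → ℚ) (Uo : ℝ)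
    (hrowL : ∀ k < m, SquareTTPrimeCorrOrbitLowerBoxRow ![P k, -27 / 50, 87 / 100] ![P (k + 1), -27 / 50, 183 / 200] (capL k) (rL k)
      Finset.univ (box 2 7) (-oddMomentObsTT (-27 / 50) Uo 0))
    (hcapL : ∀ k < m, ∀ θ ∈ Set.Icc (![P k, -27 / 50, 87 / 100] : Fin 3 → ℝ) ![P (k + 1), -27 / 50, 183 / 200],
      energyDensityTT' 1 (θ 1) (θ 0) (θ 2) ≤ capL k θ)
    (hrL : ∀ k < m, -((rL k : ℚ) : ℝ) ≤ (5166800 / 10000000 : ℝ)) :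
    PatchLeftEdge := by
  classical
  have hm : 0 < m := by
    rcases Nat.eq_zero_or_pos m with h | h
    · exfalso; subst h; rw [hP0] at hPm; norm_num at hPm
    · exact h
  have hseg : ∀ U' ∈ Set.Icc (7 / 2 : ℝ) (44 / 5), ∃ k < m, P k ≤ U' ∧ U' ≤ P (k + 1) := fun U' hU' =>
    covHg1201_exists_ladder_segment P m hm U' (by rw [hP0]; exact hU'.1) (by rw [hPm]; exact hU'.2)
  refine covHg1201M19b_PatchLeftEdge_of_cornerObjective
    (fun _ U' => if h : U' ∈ Set.Icc (7 / 2 : ℝ) (44 / 5) then ((rL (Classical.choose (hseg U' h)) : ℚ) : ℝ) else 0)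
    (fun n hn U' hU' ω Ls ψ hLs hψ h1 hω => ?_) (fun n hn U' hU' => ?_)
  · obtain ⟨hk, hPk, hPk1⟩ := Classical.choose_spec (hseg U' hU')
    rw [dif_pos hU', covHg1201_neg_oddMomentObsTT_lam_zero_label (-27 / 50) U' Uo]
    exact covHg1201_boxRow_orbitLower_at (hrowL _ hk) (hcapL _ hk) (covHg1201_vec3_mem_Icc hPk hPk1 le_rfl le_rfl hn.1 hn.2)
      ω Ls ψ hLs hψ h1 hω
  · obtain ⟨hk, -, -⟩ := Classical.choose_spec (hseg U' hU')
    rw [dif_pos hU']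
    exact hrL _ hk

/-- **`PatchBottom` (stmt-Ventures-26187) FROM ONE SHORT-BOTTOM t′-SEGMENT BOX ROW**: cell `![7/2, −27/50, 87/100]…![7/2, −13/25, 183/200]` (degenerate in `U`), word
`−X₀(−27/50)` (any `U`-label), cap discharged, slot `−rB ≤ 0.5166800` (D2 Recipe E on `[−27/50, −13/25]`: corner parent + the `(7/2, ·, −13/25)` parent, corner-objective reads
only). [cite: KomaTasaki1994, §1] [cite: BoydVandenberghe2004, §5.9] -/
theorem covHg1201M19b_PatchBottom_of_bottomBoxRow {capB : (Fin 3 → ℝ) → ℝ} {rB : ℚ} (Uo : ℝ)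
    (hrowB : SquareTTPrimeCorrOrbitLowerBoxRow ![7 / 2, -27 / 50, 87 / 100] ![7 / 2, -13 / 25, 183 / 200] capB rB Finset.univ (box 2 7)
      (-oddMomentObsTT (-27 / 50) Uo 0))
    (hcapB : ∀ θ ∈ Set.Icc (![7 / 2, -27 / 50, 87 / 100] : Fin 3 → ℝ) ![7 / 2, -13 / 25, 183 / 200],
      energyDensityTT' 1 (θ 1) (θ 0) (θ 2) ≤ capB θ)
    (hrB : -((rB : ℚ) : ℝ) ≤ (5166800 / 10000000 : ℝ)) :
    PatchBottom := by
  refine covHg1201M19b_PatchBottom_of_cornerObjective (fun _ _ => ((rB : ℚ) : ℝ))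
    (fun n hn s hs ω Ls ψ hLs hψ h1 hω => ?_) (fun n hn s hs => hrB)
  rw [covHg1201_neg_oddMomentObsTT_lam_zero_label (-27 / 50) (7 / 2) Uo]
  exact covHg1201_boxRow_orbitLower_at hrowB hcapB (covHg1201_vec3_mem_Icc le_rfl le_rfl hs.1 hs.2 hn.1 hn.2) ω Ls ψ hLs hψ h1 hω

/-! ## §3 Through the route's deciding theorem -/

/-- The rung leaf from the three edge box rows through the route's own `closes` (`PatchLeftEdge`, `PatchBottom` via §2). Bookkeeping only — the Assembly item is
the route seats'. [cite: ScalapinoWhiteZhang1993, §II] -/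
theorem covHg1201M19b_leaf_of_edgeBoxRows {capL₁ capL₂ capB : (Fin 3 → ℝ) → ℝ} {rL₁ rL₂ rB : ℚ} (Uo : ℝ)
    (hrowL₁ : SquareTTPrimeCorrOrbitLowerBoxRow ![7 / 2, -27 / 50, 87 / 100] ![5, -27 / 50, 183 / 200] capL₁ rL₁ Finset.univ (box 2 7)
      (-oddMomentObsTT (-27 / 50) Uo 0))
    (hcapL₁ : ∀ θ ∈ Set.Icc (![7 / 2, -27 / 50, 87 / 100] : Fin 3 → ℝ) ![5, -27 / 50, 183 / 200],
      energyDensityTT' 1 (θ 1) (θ 0) (θ 2) ≤ capL₁ θ)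
    (hrowL₂ : SquareTTPrimeCorrOrbitLowerBoxRow ![5, -27 / 50, 87 / 100] ![44 / 5, -27 / 50, 183 / 200] capL₂ rL₂ Finset.univ (box 2 7)
      (-oddMomentObsTT (-27 / 50) Uo 0))
    (hcapL₂ : ∀ θ ∈ Set.Icc (![5, -27 / 50, 87 / 100] : Fin 3 → ℝ) ![44 / 5, -27 / 50, 183 / 200],
      energyDensityTT' 1 (θ 1) (θ 0) (θ 2) ≤ capL₂ θ)
    (hrowB : SquareTTPrimeCorrOrbitLowerBoxRow ![7 / 2, -27 / 50, 87 / 100] ![7 / 2, -13 / 25, 183 / 200] capB rB Finset.univ (box 2 7)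
      (-oddMomentObsTT (-27 / 50) Uo 0))
    (hcapB : ∀ θ ∈ Set.Icc (![7 / 2, -27 / 50, 87 / 100] : Fin 3 → ℝ) ![7 / 2, -13 / 25, 183 / 200],
      energyDensityTT' 1 (θ 1) (θ 0) (θ 2) ≤ capB θ)
    (hrL₁ : -((rL₁ : ℚ) : ℝ) ≤ (5166800 / 10000000 : ℝ)) (hrL₂ : -((rL₂ : ℚ) : ℝ) ≤ (5166800 / 10000000 : ℝ))
    (hrB : -((rB : ℚ) : ℝ) ≤ (5166800 / 10000000 : ℝ)) :
    Summit.Ventures.CertifiedManyBodySolver.Observables.Hg1201M19b_StiffnessBoxCeiling :=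
  closes (covHg1201M19b_PatchLeftEdge_of_edgeBoxRows Uo hrowL₁ hcapL₁ hrowL₂ hcapL₂ hrL₁ hrL₂)
    (covHg1201M19b_PatchBottom_of_bottomBoxRow Uo hrowB hcapB hrB)

end Summit.Ventures.CertifiedManyBodySolver.Theorems

end
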